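import Mathlib
import Summits.Ventures.PercRepro2.CrossAPrimeA1VDict
import Summits.Ventures.PercRepro2.CrossAPrimeA1VMid
import Summits.Ventures.PercRepro2.CrossAPrimeA2V
import Summits.Ventures.PercRepro2.CrossAPrimeInduction

/-!
# The root-edge reduction at a pendant root
(blind cell PercRepro2, p5 g33; `proofs/P5-OEDGE.md` §43, S4 §2.4 (s) addendum 23)

Let the root `a₁` be PENDANT at the edge `e = {a₁, u}`: every other edge at `a₁` has weight `0`
(the hypothesis `hpend`).  With `e` pinned closed the root is isolated, so every `vL`-mass vanishes and
`crossA′so(p[e ↦ 0]) = 0` (`crossA'so_update_zero_of_pendant`).  Along `e` the one-edge cubic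
`crossA'so_pin_cubic` then has the Bernstein coefficients

  `B₀ = 0`, `3B₁ = Λ₀ := 2Z⁰Dv¹ − y⁰xv¹ − x⁰yv¹ + π¹x⁰y⁰`,
  `3B₂ = Λ₀ + B₃ − π¹(x⁰ − x¹)(y⁰ − y¹)`, `B₃ = crossA′so(p[e ↦ 1])`,

where the superscript `0` marks the `Q`-masses of `p[e ↦ 0]` and the superscript `1` the masses of
`p[e ↦ 1]`.  The dictionary `prob_update_one_Q_inter` (the `p[e ↦ 1]`-masses of `Q`-events are the
`p[e ↦ 0]`-masses under the avoidance of `{a₁, u}`) gives `Z¹ ≤ Z⁰`, `x¹ ≤ x⁰`, `y¹ ≤ y⁰`; the BHK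
bound `prob_Q_vL_oH_le` gives `xv¹ ≤ π¹x¹`, `yv¹ ≤ π¹y¹`; and the two exact identities

  `3B₂ − B₃ − B₃ = 2(Z⁰ − Z¹)Dv¹ + (y⁰ − y¹)(π¹x¹ − xv¹) + (x⁰ − x¹)(π¹y¹ − yv¹) ≥ 0`,
  `3B₁ − (3B₂ − B₃) = π¹(x⁰ − x¹)(y⁰ − y¹) ≥ 0`

give `3B₁ ≥ 3B₂ − B₃ ≥ B₃`.  Hence `0 ≤ crossA′so(p[e ↦ 1])` implies `0 ≤ crossA′so(p)`
(**`crossA'so_nonneg_of_pendant`**), i.e. the root-edge reduction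
`(1 − p e)²·crossA′so(p[e ↦ 0]) ≤ crossA′so(p)` holds at a pendant root
(**`reduction_of_pendant`**): the instances of `RootEdgeReductionStep` whose root is pendant at the
edge are theorems.  Own work; standard axioms.
-/

namespace Summit.Ventures.PercRepro2

open LeafRowPendantRootSO CrossAPrimeA1VMid CrossAPrimeA1VDict CrossAPrimeA2V CrossAPrimeSupport
  CrossAPrimeInduction

namespace CrossAPrimePendant

section Isolated

variable {V : Type*} {E : Type*} {ends : E → Sym2 V}

/-- A vertex all of whose edges are closed is its own cluster. -/
lemma cluster_eq_singleton_of_closed {ω : Config E} {a : V}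
    (h : ∀ f, a ∈ ends f → ω f = false) : cluster ends ω a = {a} := by
  apply Set.Subset.antisymm
  · intro u hu
    refine mem_of_conn_of_closed (ends := ends) (ω := ω) ?_ (Set.mem_singleton a) hu
    intro x hx y hxy
    rw [Set.mem_singleton_iff] at hx
    subst hx
    obtain ⟨_, f, hf, hends⟩ := openGraph_adj.1 hxy
    have hclosed : ω f = false := h f (by rw [hends]; exact Sym2.mem_mk_left x y)
    rw [hf] at hclosed
    exact absurd hclosed (by decide)
  · intro u hu
    rw [Set.mem_singleton_iff] at hu
    subst hu
    exact mem_cluster_self ends ω u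

end Isolated

section Pendant

variable {V : Type*} {E : Type*} [Fintype E] [DecidableEq E] {R : Type*} [Field R]
  {ends : E → Sym2 V}

omit [Fintype E] in
/-- With `e` pinned closed at a pendant root, every edge at the root has weight `0`. -/
lemma update_zero_of_pendant {p : E → R} {a₁ : V} {e : E} (hpend : ∀ f, a₁ ∈ ends f → f ≠ e → p f = 0)
    {f : E} (hf : a₁ ∈ ends f) : Function.update p e 0 f = 0 := by
  by_cases hfe : f = e
  · subst hfe
    simp
  · rw [Function.update_of_ne hfe]
    exact hpend f hf hfe

omit [Fintype E] in
/-- The sure cluster of a pendant root with `e` closed is the root alone. -/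
lemma sureCluster_eq_singleton {p : E → R} {a₁ : V} {e : E} (hpend : ∀ f, a₁ ∈ ends f → f ≠ e → p f = 0) :
    cluster ends (sureConfig (Function.update p e 0)) a₁ = {a₁} := by
  apply cluster_eq_singleton_of_closed
  intro f hf
  simp [sureConfig, update_zero_of_pendant hpend hf]

omit [Fintype E] in
/-- Every edge at the sure cluster of a pendant root (with `e` closed) is deterministic. -/
lemma det_of_pendant {p : E → R} {a₁ : V} {e : E} (hpend : ∀ f, a₁ ∈ ends f → f ≠ e → p f = 0) :
    ∀ f ∈ touches ends (cluster ends (sureConfig (Function.update p e 0)) a₁),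
      Function.update p e 0 f = 0 ∨ Function.update p e 0 f = 1 := by
  intro f hf
  rw [sureCluster_eq_singleton hpend, mem_touches] at hf
  obtain ⟨x, hx, y, hxy⟩ := hf
  rw [Set.mem_singleton_iff] at hx
  subst hx
  left
  exact update_zero_of_pendant hpend (by rw [hxy]; exact Sym2.mem_mk_left x y)

/-- At a pendant root with `e` closed, every `vL`-mass vanishes (`v ≠ a₁`). -/
lemma prob_update_zero_vL_inter {p : E → R} {a₁ : V} {e : E} (hpend : ∀ f, a₁ ∈ ends f → f ≠ e → p f = 0)
    {v : V} (hv : v ≠ a₁) (A X : Set (Config E)) :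
    prob (Function.update p e 0) (A ∩ (connEvent ends a₁ v ∩ X)) = 0 := by
  have hvS : v ∉ cluster ends (sureConfig (Function.update p e 0)) a₁ := by
    rw [sureCluster_eq_singleton hpend]
    exact hv
  have h := connEvent_inter_supp_of_not_mem (det_of_pendant hpend) hvS
  rw [prob_congr_supp _ (inter_inter_congr rfl (inter_inter_congr h rfl)), Set.empty_inter,
    Set.inter_empty, prob_empty]

/-- At a pendant root with `e` closed, `π_v = 0` (`v ≠ a₁`). -/
lemma prob_update_zero_vL {p : E → R} {a₁ : V} {e : E} (hpend : ∀ f, a₁ ∈ ends f → f ≠ e → p f = 0) {v : V}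
    (hv : v ≠ a₁) : prob (Function.update p e 0) (connEvent ends a₁ v) = 0 := by
  have h := prob_update_zero_vL_inter hpend hv Set.univ Set.univ
  rwa [Set.inter_univ, Set.univ_inter] at h

/-- At a pendant root, `crossA′so(p[e ↦ 0]) = 0`. -/
lemma crossA'so_update_zero_of_pendant {p : E → R} {a₁ : V} {e : E}
    (hpend : ∀ f, a₁ ∈ ends f → f ≠ e → p f = 0) (o a₂ : V) {v : V} (hv : v ≠ a₁) (b : V) :
    crossA'so (Function.update p e 0) ends o a₁ a₂ v b = 0 := by
  unfold crossA'so
  simp only [prob_update_zero_vL_inter hpend hv, prob_update_zero_vL hpend hv, mul_zero, zero_mul,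
    sub_zero, add_zero]

end Pendant

section Main

variable {V : Type*} {E : Type*} [Fintype E] [DecidableEq E] [Fintype V] [DecidableEq V]
  {R : Type*} [Field R] [LinearOrder R] [IsStrictOrderedRing R]
variable {ends : E → Sym2 V}

/-- **The sign at a pendant root**, given the sign with `e` pinned open: `3B₁ ≥ 3B₂ − B₃ ≥ B₃ ≥ 0`
along the one-edge cubic. -/
theorem crossA'so_nonneg_of_pendant {p : E → R} (hp : IsProbVec p) {e : E} {a₁ u : V}
    (he : ends e = s(a₁, u)) (hpend : ∀ f, a₁ ∈ ends f → f ≠ e → p f = 0) (o a₂ : V) {v : V} (hv : v ≠ a₁)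
    (b : V) (h3 : 0 ≤ crossA'so (Function.update p e 1) ends o a₁ a₂ v b) :
    0 ≤ crossA'so p ends o a₁ a₂ v b := by
  classical
  have hp0 : IsProbVec (Function.update p e 0) := hp.update e le_rfl zero_le_one
  have hp1 : IsProbVec (Function.update p e 1) := hp.update e zero_le_one le_rfl
  have hq0 : 0 ≤ p e := hp.nonneg e
  have hq1 : p e ≤ 1 := hp.le_one e
  rw [crossA'so_pin_cubic p ends e]
  rw [crossA'so_eq_crossPat] at h3
  unfold crossPat at h3 ⊢
  simp only [prob_update_zero_vL_inter hpend hv, prob_update_zero_vL hpend hv, mul_zero, zero_mul,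
    sub_zero, add_zero, zero_add]
  -- the dictionary: the `Q`-masses of `p[e ↦ 1]` are `p[e ↦ 0]`-masses under the double avoidance
  have dZ : prob (Function.update p e 1) (avoidAll ends a₂ {a₁}) =
      prob (Function.update p e 0) (avoidAll ends a₂ {a₁, u}) := by
    have := prob_update_one_Q_inter (R := R) p he (a₂ := a₂) (X := Set.univ) (hX_univ (a₂ := a₂))
    simpa only [Set.inter_univ] using this
  have dx : prob (Function.update p e 1) (avoidAll ends a₂ {a₁} ∩ connEvent ends a₂ o) =
      prob (Function.update p e 0) (avoidAll ends a₂ {a₁, u} ∩ connEvent ends a₂ o) :=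
    prob_update_one_Q_inter p he (hX_conn he a₂ o)
  have dy : prob (Function.update p e 1) (avoidAll ends a₂ {a₁} ∩ connEvent ends a₂ b) =
      prob (Function.update p e 0) (avoidAll ends a₂ {a₁, u} ∩ connEvent ends a₂ b) :=
    prob_update_one_Q_inter p he (hX_conn he a₂ b)
  -- the monotone comparisons `Z¹ ≤ Z⁰`, `x¹ ≤ x⁰`, `y¹ ≤ y⁰`
  have hZ : prob (Function.update p e 1) (avoidAll ends a₂ {a₁}) ≤
      prob (Function.update p e 0) (avoidAll ends a₂ {a₁}) := by
    rw [dZ]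
    exact prob_mono hp0 (avoid_pair_subset a₂)
  have hx : prob (Function.update p e 1) (avoidAll ends a₂ {a₁} ∩ connEvent ends a₂ o) ≤
      prob (Function.update p e 0) (avoidAll ends a₂ {a₁} ∩ connEvent ends a₂ o) := by
    rw [dx]
    exact prob_mono hp0 (Set.inter_subset_inter_left _ (avoid_pair_subset a₂))
  have hy : prob (Function.update p e 1) (avoidAll ends a₂ {a₁} ∩ connEvent ends a₂ b) ≤
      prob (Function.update p e 0) (avoidAll ends a₂ {a₁} ∩ connEvent ends a₂ b) := by
    rw [dy]
    exact prob_mono hp0 (Set.inter_subset_inter_left _ (avoid_pair_subset a₂))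
  -- the BHK bounds `xv¹ ≤ π¹x¹`, `yv¹ ≤ π¹y¹`
  have hxv := prob_Q_vL_oH_le (ends := ends) (Function.update p e 1) hp1 a₁ a₂ v o
  have hyv := prob_Q_vL_oH_le (ends := ends) (Function.update p e 1) hp1 a₁ a₂ v b
  -- names
  set Z₀ := prob (Function.update p e 0) (avoidAll ends a₂ {a₁}) with hZ₀
  set x₀ := prob (Function.update p e 0) (avoidAll ends a₂ {a₁} ∩ connEvent ends a₂ o) with hx₀
  set y₀ := prob (Function.update p e 0) (avoidAll ends a₂ {a₁} ∩ connEvent ends a₂ b) with hy₀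
  set Z₁ := prob (Function.update p e 1) (avoidAll ends a₂ {a₁}) with hZ₁
  set x₁ := prob (Function.update p e 1) (avoidAll ends a₂ {a₁} ∩ connEvent ends a₂ o) with hx₁
  set y₁ := prob (Function.update p e 1) (avoidAll ends a₂ {a₁} ∩ connEvent ends a₂ b) with hy₁
  set Dv := prob (Function.update p e 1) (avoidAll ends a₂ {a₁} ∩
    (connEvent ends a₁ v ∩ (connEvent ends a₂ o ∩ connEvent ends a₂ b))) with hDv
  set xv := prob (Function.update p e 1) (avoidAll ends a₂ {a₁} ∩
    (connEvent ends a₁ v ∩ connEvent ends a₂ o)) with hxv₁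
  set yv := prob (Function.update p e 1) (avoidAll ends a₂ {a₁} ∩
    (connEvent ends a₁ v ∩ connEvent ends a₂ b)) with hyv₁
  set π := prob (Function.update p e 1) (connEvent ends a₁ v) with hπ
  have hDv0 : 0 ≤ Dv := prob_nonneg hp1 _
  have hπ0 : 0 ≤ π := prob_nonneg hp1 _
  have hx10 : 0 ≤ x₁ := prob_nonneg hp1 _
  have hy10 : 0 ≤ y₁ := prob_nonneg hp1 _
  -- `3B₂ − B₃ − B₃ ≥ 0` and `3B₁ − (3B₂ − B₃) ≥ 0`
  have hE : 0 ≤ 2 * (Z₀ - Z₁) * Dv + (y₀ - y₁) * (π * x₁ - xv) + (x₀ - x₁) * (π * y₁ - yv) := by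
    have h1 : 0 ≤ 2 * (Z₀ - Z₁) * Dv := by
      apply mul_nonneg (mul_nonneg (by norm_num) (sub_nonneg.2 hZ)) hDv0
    have h2 : 0 ≤ (y₀ - y₁) * (π * x₁ - xv) := mul_nonneg (sub_nonneg.2 hy) (sub_nonneg.2 hxv)
    have h3' : 0 ≤ (x₀ - x₁) * (π * y₁ - yv) := mul_nonneg (sub_nonneg.2 hx) (sub_nonneg.2 hyv)
    linarith
  have hX : 0 ≤ π * ((x₀ - x₁) * (y₀ - y₁)) :=
    mul_nonneg hπ0 (mul_nonneg (sub_nonneg.2 hx) (sub_nonneg.2 hy))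
  -- the three Bernstein blocks
  have hq01 : 0 ≤ p e * (1 - p e) ^ 2 := mul_nonneg hq0 (sq_nonneg _)
  have hq2 : 0 ≤ p e ^ 2 * (1 - p e) := mul_nonneg (sq_nonneg _) (sub_nonneg.2 hq1)
  have hq3 : 0 ≤ p e ^ 3 := pow_nonneg hq0 3
  have hB3 : 0 ≤ 2 * Z₁ * Dv - y₁ * xv + π * x₁ * y₁ - x₁ * yv := by linarith [h3]
  have hE2 : 0 ≤ 2 * Z₀ * Dv - y₀ * xv - x₀ * yv + π * x₁ * y₀ + π * x₀ * y₁ - π * x₁ * y₁ := by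
    linarith [hE, hB3]
  have hΛ : 0 ≤ 2 * Z₀ * Dv - y₀ * xv - x₀ * yv + π * x₀ * y₀ := by
    linarith [hE2, hX]
  have h1 := mul_nonneg hq01 hΛ
  have h2 := mul_nonneg hq2 (add_nonneg hE2 hB3)
  have h3' := mul_nonneg hq3 hB3
  linarith [h1, h2, h3']

/-- **The root-edge reduction at a pendant root**:
`(1 − p e)²·crossA′so(p[e ↦ 0]) ≤ crossA′so(p)` given `0 ≤ crossA′so(p[e ↦ 1])` (the left side
is `0`). -/
theorem reduction_of_pendant {p : E → R} (hp : IsProbVec p) {e : E} {a₁ u : V}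
    (he : ends e = s(a₁, u)) (hpend : ∀ f, a₁ ∈ ends f → f ≠ e → p f = 0) (o a₂ : V) {v : V} (hv : v ≠ a₁)
    (b : V) (h3 : 0 ≤ crossA'so (Function.update p e 1) ends o a₁ a₂ v b) :
    (1 - p e) ^ 2 * crossA'so (Function.update p e 0) ends o a₁ a₂ v b ≤
      crossA'so p ends o a₁ a₂ v b := by
  rw [crossA'so_update_zero_of_pendant hpend o a₂ hv b, mul_zero]
  exact crossA'so_nonneg_of_pendant hp he hpend o a₂ hv b h3

end Main

end CrossAPrimePendant

end Summit.Ventures.PercRepro2
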